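import Summits.CriticalPhenomena.PercolationContinuityZ3.Theorems.PercNearOneGluingNoHeavyQuantLightSiblingForest
import HarnessLib

/-!
# QUANT lane R8, T-DEC: ADDING A TAME SIBLING TO ANY SDEC FOREST, MODULO THE COMPENSATED SUB-FLOOR SLICE — the node `SiblingStep` for every
# forest with at least one tame sibling, conditionally on COMP-SLICE (arm-1 gen 56, architect)

builds on p205010 (kernel theorem, internal audit signed; external expert review pending)

Support file (`--supports stmt-CriticalPhenomena-4575`), QUANT lane seat prim-quant-arm-1 (gen 56, architect); memo
`run/shared/lean/prim/quant/prim-quant-arm-1-g56/ARCH-G56.md` §0 (6a), §4.  Theorems only (the conjecture COMP-SLICE enters as an explicit HYPOTHESIS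
`hCS`, spelled out — no definition, nothing is claimed unconditionally); standard axioms, no sorries.

COMP-SLICE (conjecture, memo §4; 0 failures on 2 015 random + 1 500 adversarial kernel-faithful LP instances): for a probability law `β` on `{0..B}`, SDEC and
affordable at `x`, and a LIGHT affordable piece `{lo, lo+K; γ}` (`0 ≤ γ ≤ 1`, `Kγ ≤ lo`, `x(lo+K) ≤ lo + Kγ` — ANY `γ`, below the floor allowed):
`{lo, lo+K; γ} ∗ β` is SDEC at `x` on `{0..lo+K+B}`.  It holds for `β = δ₀` (`sdec_hubCore_light`) and for `γ ≥ x` (the slice lemmas).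

* **`sdec_cons_of_tame_of_compSlice`** — COMP-SLICE at `x` ⟹ for law-OK affordable siblings `L` with `SDEC x (ftop L) (flaw L)` (from anywhere: the oracle,
  `sdec_flaw_of_tame`, …) and a TAME affordable sibling `s`: `SDEC x (ftop (s :: L)) (flaw (s :: L))` — the induction step of `…QuantLightSiblingForest` with the
  empty core, the light pieces served by COMP-SLICE instead of the core.
* **`sdec_siblings_of_tame_of_compSlice`** — in the node's list binder (`siblingStep_iff_list`): COMP-SLICE at `x` ∧ the oracle below the gate budget of
  `s :: L` ∧ `s` tame ⟹ `SDEC x (ftop (s :: L)) (flaw (s :: L))`.  So, GIVEN COMP-SLICE, the sibling step owes only forests ALL of whose siblings are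
  heavy-unfloored (the near-sure corner); unconditionally it owes the complement of `sdec_flaw_of_tame` (memo §3).

HONEST STATUS.  Conditional results; COMP-SLICE, `SiblingStep` / `GateStepN` / `LightResidDECOracle` / `FarTreeRow` OPEN; RATE class (log\*) / honest
sentence of `run/shared/lean/prim/quant/README.md` unchanged.  [this work].  Nothing here is cited as a published result.  The gluing rows served
[cite: KozmaNitzan2024, Conjecture 3 (p. 15)]; product measure [cite: Grimmett1999, §1.3 p. 10].
-/

noncomputable section

open scoped BigOperators

namespace Summit.CriticalPhenomena.PercolationContinuityZ3.Theorems
namespace Quant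
namespace LawDec

open Finset

/-- the point mass `δ_K` -/
local notation3 "δ[" K "]" => (fun k : ℕ => if k = (K : ℕ) then (1 : ℝ) else 0)

/-- the two-point law `{lo, lo+K; g}` = `lo` sure relays and a blob of size `K` at gate `g` -/
local notation3 "TPL[" lo ", " K ", " g "]" => lconv lo K δ[lo] (gate δ[K] g)

/-- the two-point law as a pseudo-sibling with the sure root gate `1` -/
local notation3 "HS[" lo ", " K ", " g "]" => (⟨1, 0, 0, lo + K, TPL[lo, K, g]⟩ : Sib)

/-- the hub-core of elements `(lo, K, γ)` -/
local notation3 "HC[" cs "]" => List.map (fun c : ℕ × ℕ × ℝ => HS[c.1, c.2.1, c.2.2]) cs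

/-- **ADDING A TAME SIBLING TO AN SDEC FOREST, GIVEN COMP-SLICE.**  `hCS` = COMP-SLICE at `x` for the forest law `flaw L` (every LIGHT affordable piece
`{lo, lo+K; γ}`, any gate `γ ∈ [0,1]`, convolved with `flaw L` is SDEC at `x`); `L` law-OK with per-sibling affordability and `SDEC x (ftop L) (flaw L)`; `s` law-OK,
affordable and TAME at `x` ⟹ `SDEC x (ftop (s :: L)) (flaw (s :: L))`. [this work] -/
theorem sdec_cons_of_tame_of_compSlice {x : ℝ} (hx0 : 0 < x) (hx1 : x < 1) (L : List Sib) (s : Sib)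
    (hL : ∀ t ∈ L, t.LawOK) (hxL : ∀ t ∈ L, x * (t.M : ℝ) ≤ t.q * t.mean) (hS : SDEC x (ftop L) (flaw L))
    (hs : s.LawOK) (hxs : x * (s.M : ℝ) ≤ s.q * s.mean)
    (htame : ∀ h : ℕ, 1 ≤ h → s.ρ h ≠ 0 → s.q * s.mean ≤ 2 * h ∨ x * ((s.M : ℝ) - h) ≤ s.q * s.mean - h)
    (hCS : ∀ (lo K : ℕ) (γ : ℝ), 0 ≤ γ → γ ≤ 1 → (K : ℝ) * γ ≤ lo → x * ((lo : ℝ) + K) ≤ lo + K * γ →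
      SDEC x (lo + K + ftop L) (lconv (lo + K) (ftop L) (TPL[lo, K, γ]) (flaw L))) :
    SDEC x (ftop (s :: L)) (flaw (s :: L)) := by
  obtain ⟨_, fM, _, _⟩ := flaw_facts L hL
  obtain ⟨_, gM, _, _⟩ := flaw_facts (s :: L) (fun t ht => by
    rcases List.mem_cons.1 ht with rfl | ht
    · exact hs
    · exact hL t ht)
  -- the step of `…QuantLightSiblingForest` with the EMPTY core; light pieces are served by COMP-SLICE
  have key := sdec_hubCore_flaw_step hx0 hx1 [] L s hL hxL hs hxs htame (fun c hc => by simp at hc) (fun c hc => by simp at hc)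
    (fun c hc => by simp at hc) ?_ ?_
  · have e : lconv (ftop HC[([] : List (ℕ × ℕ × ℝ))]) (ftop (s :: L)) (flaw HC[([] : List (ℕ × ℕ × ℝ))]) (flaw (s :: L)) = flaw (s :: L) := by
      funext h; simp only [List.map_nil, flaw]; exact lconv_delta_left _ _ _ gM h
    rw [e] at key
    simpa [ftop] using key
  · -- the base: `δ₀ ∗ flaw L = flaw L`
    have e : lconv (ftop HC[([] : List (ℕ × ℕ × ℝ))]) (ftop L) (flaw HC[([] : List (ℕ × ℕ × ℝ))]) (flaw L) = flaw L := by
      funext h; simp only [List.map_nil, flaw]; exact lconv_delta_left _ _ _ fM h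
    rw [e]
    simpa [ftop] using hS
  · -- one light piece beside `flaw L`: COMP-SLICE
    intro c hc0 hc1 hcl hca
    have h := hCS c.1 c.2.1 c.2.2 hc0 hc1 hcl hca
    have e : flaw HC[[c]] = TPL[c.1, c.2.1, c.2.2] := by
      rw [flaw_hubCore_cons]
      funext k
      simp only [List.map_nil, flaw, ftop]
      exact lconv_delta_left _ _ _ (hs_facts c.1 c.2.1 c.2.2 hc0 hc1).2.1 k
    have et : ftop HC[[c]] = c.1 + c.2.1 := by simp [ftop]
    rw [e, et]
    exact h

/-- **THE NODE FOR FORESTS WITH A TAME SIBLING, GIVEN COMP-SLICE** (list binder of `siblingStep_iff_list`; the tame sibling written first — `flaw` is a commutative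
convolution): tree-OK siblings `s :: L` at `0 < x < 1`, the oracle below the gate budget `fgates (s :: L)`, COMP-SLICE at `x` for `flaw L`, and `s` TAME at `x`
⟹ `SDEC x (ftop (s :: L)) (flaw (s :: L))`. [this work] -/
theorem sdec_siblings_of_tame_of_compSlice {x : ℝ} (hx0 : 0 < x) (hx1 : x < 1) (L : List Sib) (s : Sib) (hL : ∀ t ∈ s :: L, t.TreeOK x)
    (hO : ∀ (x' : ℝ) (n' M' : ℕ) (μ' : ℕ → ℝ), n' < fgates (s :: L) → TreeBuiltN x' n' M' μ' → SDEC x' M' μ')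
    (htame : ∀ h : ℕ, 1 ≤ h → s.ρ h ≠ 0 → s.q * s.mean ≤ 2 * h ∨ x * ((s.M : ℝ) - h) ≤ s.q * s.mean - h)
    (hCS : ∀ (lo K : ℕ) (γ : ℝ), 0 ≤ γ → γ ≤ 1 → (K : ℝ) * γ ≤ lo → x * ((lo : ℝ) + K) ≤ lo + K * γ →
      SDEC x (lo + K + ftop L) (lconv (lo + K) (ftop L) (TPL[lo, K, γ]) (flaw L))) :
    SDEC x (ftop (s :: L)) (flaw (s :: L)) := by
  have hL' : ∀ t ∈ L, t.TreeOK x := fun t ht => hL t (List.mem_cons_of_mem s ht)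
  have hs : s.TreeOK x := hL s List.mem_cons_self
  -- the oracle certifies the rest of the forest: `flaw L` is tree-built on `fgates L < fgates (s :: L)` gates
  have hSL : SDEC x (ftop L) (flaw L) :=
    hO x (fgates L) (ftop L) (flaw L) (by simp [fgates]) (compForestN_of_list hx0 hx1 L hL').treeBuiltN
  exact sdec_cons_of_tame_of_compSlice hx0 hx1 L s (fun t ht => (hL' t ht).lawOK) (fun t ht => (hL' t ht).afford) hSL hs.lawOK hs.afford
    htame hCS

end LawDec
end Quant
end Summit.CriticalPhenomena.PercolationContinuityZ3.Theorems
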